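import Mathlib
import HarnessLib
import Summits.HubbardSuperconductivity.HubbardSuperconductivity.Theorems.KLProgrammeKLRegimeVolumeLimitSecondOrderWick

/-!
# Child `KLRegimeVolumeLimit` (stmt-HubbardSuperconductivity-19665 / its gen-3 twin) — the ORDER-`U²` RUNG of the volume-limit
# carrier, Wick evaluation III: the six-point function `∫ ∂⁺_{k↓}W · ∂⁻_{k↓}W` (spin-`↓` external legs) (seat hubbard-kl-k3c5-p3)

The spin-`↓` twin of `…SecondOrderSunsetUp`: `∂⁺_{k↓}W = (βL²)⁻³ Σ_{k₁+k=k₂+k₄} ψ̂⁺_{k₁↑}ψ̂⁻_{k₂↑}ψ̂⁻_{k₄↓}`,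
`∂⁻_{k↓}W = −(βL²)⁻³ Σ_{k₁+k₃=k₂+k} ψ̂⁺_{k₁↑}ψ̂⁻_{k₂↑}ψ̂⁺_{k₃↓}`; here the first field `ψ̂⁺_{k₁↑}` has TWO partners, so the
integration by parts produces two mixed four-point functions (`gaussExpect_fourPoint_mixed₁/₂`), each with a single pairing.  Summing
the vertex constraints and relabelling the exchange term into the spin-`↑` sunset sum:

  `∫ ∂⁺_{k↓}W · ∂⁻_{k↓}W = (βL²)⁻⁶ (βL²)³ (Sun(k) − ĝ(k) T²)`,  `Sun(k) = Σ_{k+k₃=k₂+k₄} ĝ(k₂)ĝ(k₃)ĝ(k₄)`,  `T = Σ_q ĝ(q)`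

(`gaussExpect_dPlus_mul_dMinus_down`) — the same value as for spin `↑` (spin symmetry, made explicit).  Everything is proved; no
definition.
-/

noncomputable section

namespace Summit.HubbardSuperconductivity.HubbardSuperconductivity.Theorems.TwoPointAssembly

set_option linter.dupNamespace false -- summit = problem name (single-conjunct summit), D-0017

open Finset Filter Topology Literature.MathematicalPhysics.QuantumLattice Literature.Probability.LatticeModels GrassmannAlgebra
open Summit.HubbardSuperconductivity.HubbardSuperconductivity.Theorems.KLRegimeSplit
open Summit.HubbardSuperconductivity.HubbardSuperconductivity.Theorems.KLProgrammeLegKernels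

variable {L M : ℕ} [NeZero L]

/-! ## The six-point function, spin `↓` external legs -/

omit [NeZero L] in
/-- `∂_{ψ̂⁺_{k↓}} (ψ̂⁺_{k₁↑}ψ̂⁻_{k₂↑}ψ̂⁺_{k₃↓}ψ̂⁻_{k₄↓}) = [k₃ = k] ψ̂⁺_{k₁↑}ψ̂⁻_{k₂↑}ψ̂⁻_{k₄↓}` (two sign flips). -/
theorem grassmannDeriv_psiPlus_down_vertexMonomial (k k₁ k₂ k₃ k₄ : FreqMomentum L M) :
    grassmannDeriv ℂ (((k, 1), 0) : HubbardFieldIdx L M) (psiPlus k₁ 0 * psiMinus k₂ 0 * psiPlus k₃ 1 * psiMinus k₄ 1) =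
      if k₃ = k then psiPlus k₁ 0 * (psiMinus k₂ 0 * psiMinus k₄ 1) else 0 := by
  simp only [psiPlus, psiMinus, mul_assoc, grassmannDeriv_gen_mul, grassmannDeriv_gen]
  by_cases h : k₃ = k
  · subst h; simp
  · simp [h, Ne.symm h]

/-- **`∂⁺_{k↓} W = (βL²)⁻³ Σ_{k₁+k=k₂+k₄} ψ̂⁺_{k₁↑}ψ̂⁻_{k₂↑}ψ̂⁻_{k₄↓}`.** -/
theorem dPlus_down_hubbardInteraction (β : ℝ) (k : FreqMomentum L M) :
    grassmannDeriv ℂ (((k, 1), 0) : HubbardFieldIdx L M) (hubbardInteraction L M β 1) =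
      (((1 / (β * (L : ℝ) ^ 2) ^ 3 : ℝ) : ℂ)) • ∑ k₁ : FreqMomentum L M, ∑ k₂ : FreqMomentum L M, ∑ k₄ : FreqMomentum L M,
        if matsubaraInt M k₁.1 + matsubaraInt M k.1 = matsubaraInt M k₂.1 + matsubaraInt M k₄.1 ∧ k₁.2 + k.2 = k₂.2 + k₄.2 then
          psiPlus k₁ 0 * (psiMinus k₂ 0 * psiMinus k₄ 1) else 0 := by
  rw [hubbardInteraction]
  simp only [map_smul, map_sum, grassmannDeriv_ite, grassmannDeriv_psiPlus_down_vertexMonomial]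
  congr 1
  refine Finset.sum_congr rfl fun k₁ _ => Finset.sum_congr rfl fun k₂ _ => ?_
  rw [Finset.sum_eq_single k]
  · simp only [if_true]
  · intro k₃ _ h
    exact Finset.sum_eq_zero fun k₄ _ => by simp [h]
  · intro h; exact absurd (Finset.mem_univ _) h

/-- **`∂⁻_{k↓} W = (βL²)⁻³ Σ_{k₁+k₃=k₂+k} (−ψ̂⁺_{k₁↑}ψ̂⁻_{k₂↑}ψ̂⁺_{k₃↓})`.** -/
theorem dMinus_down_hubbardInteraction (β : ℝ) (k : FreqMomentum L M) :
    grassmannDeriv ℂ (((k, 1), 1) : HubbardFieldIdx L M) (hubbardInteraction L M β 1) =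
      (((1 / (β * (L : ℝ) ^ 2) ^ 3 : ℝ) : ℂ)) • ∑ k₁ : FreqMomentum L M, ∑ k₂ : FreqMomentum L M, ∑ k₃ : FreqMomentum L M,
        if matsubaraInt M k₁.1 + matsubaraInt M k₃.1 = matsubaraInt M k₂.1 + matsubaraInt M k.1 ∧ k₁.2 + k₃.2 = k₂.2 + k.2 then
          -(psiPlus k₁ 0 * (psiMinus k₂ 0 * psiPlus k₃ 1)) else 0 := by
  rw [hubbardInteraction]
  simp only [map_smul, map_sum, grassmannDeriv_ite, grassmannDeriv_psiMinus_down_vertexMonomial]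
  congr 1
  refine Finset.sum_congr rfl fun k₁ _ => Finset.sum_congr rfl fun k₂ _ => Finset.sum_congr rfl fun k₃ _ => ?_
  rw [Finset.sum_eq_single k]
  · simp only [if_true]
  · intro k₄ _ h; simp [h]
  · intro h; exact absurd (Finset.mem_univ _) h

omit [NeZero L] in
/-- The inner derivative of the six-point monomial (spin `↓` case): `∂_{ψ̂⁻_{k₁↑}}` responds to `ψ̂⁻_{k₂↑}` and to `ψ̂⁻_{k₂'↑}`. -/
theorem grassmannDeriv_sixPoint_down (k₁ k₂ k₄ k₁' k₂' k₃' : FreqMomentum L M) :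
    grassmannDeriv ℂ (((k₁, 0), 1) : HubbardFieldIdx L M)
        (gen ℂ (((k₂, 0), 1) : HubbardFieldIdx L M) * (gen ℂ (((k₄, 1), 1) : HubbardFieldIdx L M) *
          (gen ℂ (((k₁', 0), 0) : HubbardFieldIdx L M) * (gen ℂ (((k₂', 0), 1) : HubbardFieldIdx L M) *
            gen ℂ (((k₃', 1), 0) : HubbardFieldIdx L M))))) =
      (if k₂ = k₁ then
        gen ℂ (((k₄, 1), 1) : HubbardFieldIdx L M) * (gen ℂ (((k₁', 0), 0) : HubbardFieldIdx L M) *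
          (gen ℂ (((k₂', 0), 1) : HubbardFieldIdx L M) * gen ℂ (((k₃', 1), 0) : HubbardFieldIdx L M))) else 0) -
      (if k₂' = k₁ then
        gen ℂ (((k₂, 0), 1) : HubbardFieldIdx L M) * (gen ℂ (((k₄, 1), 1) : HubbardFieldIdx L M) *
          (gen ℂ (((k₁', 0), 0) : HubbardFieldIdx L M) * gen ℂ (((k₃', 1), 0) : HubbardFieldIdx L M))) else 0) := by
  simp only [grassmannDeriv_gen_mul, grassmannDeriv_gen]
  by_cases h : k₂ = k₁
  · subst h
    by_cases h' : k₂' = k₂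
    · subst h'; simp
    · simp [h', Ne.symm h']
  · by_cases h' : k₂' = k₁
    · subst h'; simp [h, Ne.symm h]
    · simp [h, Ne.symm h, h', Ne.symm h']

/-- First four-point function of the spin-`↓` case: `∫ ψ̂⁻_{k₄↓} ψ̂⁺_{k₁'↑} ψ̂⁻_{k₂'↑} ψ̂⁺_{k₃'↓} = −(βL²)² ĝ(k₄) ĝ(k₁') [k₃'=k₄][k₂'=k₁']`. -/
theorem gaussExpect_fourPoint_mixed₁ {β : ℝ} (hβ : β ≠ 0) (μ : ℝ) (K : TrigPolyC4v) (k₄ k₁' k₂' k₃' : FreqMomentum L M) :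
    gaussExpect ℂ (hubbardCovarianceCT L M β μ 0 K)
        (gen ℂ (((k₄, 1), 1) : HubbardFieldIdx L M) * (gen ℂ (((k₁', 0), 0) : HubbardFieldIdx L M) *
          (gen ℂ (((k₂', 0), 1) : HubbardFieldIdx L M) * gen ℂ (((k₃', 1), 0) : HubbardFieldIdx L M)))) =
      if k₃' = k₄ then (if k₂' = k₁' then
        -(((β * (L : ℝ) ^ 2 : ℝ) : ℂ) ^ 2 * propCT L M β μ K k₄ * propCT L M β μ K k₁') else 0) else 0 := by
  have hd : grassmannDeriv ℂ (((k₄, 1), 0) : HubbardFieldIdx L M)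
      (gen ℂ (((k₁', 0), 0) : HubbardFieldIdx L M) * (gen ℂ (((k₂', 0), 1) : HubbardFieldIdx L M) *
        gen ℂ (((k₃', 1), 0) : HubbardFieldIdx L M))) =
      if k₃' = k₄ then gen ℂ (((k₁', 0), 0) : HubbardFieldIdx L M) * gen ℂ (((k₂', 0), 1) : HubbardFieldIdx L M) else 0 := by
    simp only [grassmannDeriv_gen_mul, grassmannDeriv_gen]
    by_cases h : k₃' = k₄
    · subst h; simp
    · simp [h, Ne.symm h]
  rw [gaussExpect_psiMinus_mul hβ, hd, gaussExpect_ite, gaussExpect_psiPlus_psiMinus hβ]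
  simp only [and_true]
  split_ifs <;> ring

/-- Second four-point function of the spin-`↓` case: `∫ ψ̂⁻_{k₂↑} ψ̂⁻_{k₄↓} ψ̂⁺_{k₁'↑} ψ̂⁺_{k₃'↓} = −(βL²)² ĝ(k₂) ĝ(k₄) [k₁'=k₂][k₃'=k₄]`. -/
theorem gaussExpect_fourPoint_mixed₂ {β : ℝ} (hβ : β ≠ 0) (μ : ℝ) (K : TrigPolyC4v) (k₂ k₄ k₁' k₃' : FreqMomentum L M) :
    gaussExpect ℂ (hubbardCovarianceCT L M β μ 0 K)
        (gen ℂ (((k₂, 0), 1) : HubbardFieldIdx L M) * (gen ℂ (((k₄, 1), 1) : HubbardFieldIdx L M) *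
          (gen ℂ (((k₁', 0), 0) : HubbardFieldIdx L M) * gen ℂ (((k₃', 1), 0) : HubbardFieldIdx L M)))) =
      if k₁' = k₂ then (if k₃' = k₄ then
        -(((β * (L : ℝ) ^ 2 : ℝ) : ℂ) ^ 2 * propCT L M β μ K k₂ * propCT L M β μ K k₄) else 0) else 0 := by
  have hd : grassmannDeriv ℂ (((k₂, 0), 0) : HubbardFieldIdx L M)
      (gen ℂ (((k₄, 1), 1) : HubbardFieldIdx L M) * (gen ℂ (((k₁', 0), 0) : HubbardFieldIdx L M) *
        gen ℂ (((k₃', 1), 0) : HubbardFieldIdx L M))) =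
      if k₁' = k₂ then -(gen ℂ (((k₄, 1), 1) : HubbardFieldIdx L M) * gen ℂ (((k₃', 1), 0) : HubbardFieldIdx L M)) else 0 := by
    simp only [grassmannDeriv_gen_mul, grassmannDeriv_gen]
    by_cases h : k₁' = k₂
    · subst h; simp
    · simp [h, Ne.symm h]
  rw [gaussExpect_psiMinus_mul hβ, hd, gaussExpect_ite, map_neg, gaussExpect_psiMinus_psiPlus hβ]
  simp only [and_true]
  split_ifs <;> ring

/-- **The spin-`↓` six-point function**:
`∫ ψ̂⁺_{k₁↑}ψ̂⁻_{k₂↑}ψ̂⁻_{k₄↓} ψ̂⁺_{k₁'↑}ψ̂⁻_{k₂'↑}ψ̂⁺_{k₃'↓} = (βL²)³ (ĝ(k₁)ĝ(k₄)ĝ(k₁')[k₂=k₁][k₃'=k₄][k₂'=k₁'] − ĝ(k₁)ĝ(k₂)ĝ(k₄)[k₂'=k₁][k₁'=k₂][k₃'=k₄])`. -/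
theorem gaussExpect_sixPoint_down {β : ℝ} (hβ : β ≠ 0) (μ : ℝ) (K : TrigPolyC4v) (k₁ k₂ k₄ k₁' k₂' k₃' : FreqMomentum L M) :
    gaussExpect ℂ (hubbardCovarianceCT L M β μ 0 K)
        (gen ℂ (((k₁, 0), 0) : HubbardFieldIdx L M) * (gen ℂ (((k₂, 0), 1) : HubbardFieldIdx L M) *
          (gen ℂ (((k₄, 1), 1) : HubbardFieldIdx L M) * (gen ℂ (((k₁', 0), 0) : HubbardFieldIdx L M) *
            (gen ℂ (((k₂', 0), 1) : HubbardFieldIdx L M) * gen ℂ (((k₃', 1), 0) : HubbardFieldIdx L M)))))) =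
      (if k₂ = k₁ then (if k₃' = k₄ then (if k₂' = k₁' then
          ((β * (L : ℝ) ^ 2 : ℝ) : ℂ) ^ 3 * propCT L M β μ K k₁ * propCT L M β μ K k₄ * propCT L M β μ K k₁' else 0) else 0) else 0) -
      (if k₂' = k₁ then (if k₁' = k₂ then (if k₃' = k₄ then
          ((β * (L : ℝ) ^ 2 : ℝ) : ℂ) ^ 3 * propCT L M β μ K k₁ * propCT L M β μ K k₂ * propCT L M β μ K k₄ else 0) else 0) else 0) := by
  rw [gaussExpect_psiPlus_mul hβ, grassmannDeriv_sixPoint_down, map_sub, gaussExpect_ite, gaussExpect_ite,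
    gaussExpect_fourPoint_mixed₁ hβ, gaussExpect_fourPoint_mixed₂ hβ]
  split_ifs <;> ring

/-- **`∫ ∂⁺_{k↓}W · ∂⁻_{k↓}W = (βL²)⁻⁶ · (βL²)³ · (Sun(k) − ĝ(k) T²)`** — the spin-`↓` twin of `gaussExpect_dPlus_mul_dMinus_up`, with the
SAME sunset sum `Sun(k) = Σ_{k+k₃=k₂+k₄} ĝ(k₂)ĝ(k₃)ĝ(k₄)` (relabelled). -/
theorem gaussExpect_dPlus_mul_dMinus_down {β : ℝ} (hβ : β ≠ 0) (μ : ℝ) (K : TrigPolyC4v) (k : FreqMomentum L M) :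
    gaussExpect ℂ (hubbardCovarianceCT L M β μ 0 K)
        (grassmannDeriv ℂ (((k, 1), 0) : HubbardFieldIdx L M) (hubbardInteraction L M β 1) *
          grassmannDeriv ℂ (((k, 1), 1) : HubbardFieldIdx L M) (hubbardInteraction L M β 1)) =
      (((1 / (β * (L : ℝ) ^ 2) ^ 3 : ℝ) : ℂ)) ^ 2 * (((β * (L : ℝ) ^ 2 : ℝ) : ℂ) ^ 3 *
        ((∑ k₂ : FreqMomentum L M, ∑ k₃ : FreqMomentum L M, ∑ k₄ : FreqMomentum L M,
            if matsubaraInt M k.1 + matsubaraInt M k₃.1 = matsubaraInt M k₂.1 + matsubaraInt M k₄.1 ∧ k.2 + k₃.2 = k₂.2 + k₄.2 then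
              propCT L M β μ K k₂ * propCT L M β μ K k₃ * propCT L M β μ K k₄ else 0) -
          propCT L M β μ K k * (∑ q : FreqMomentum L M, propCT L M β μ K q) ^ 2)) := by
  set c : ℂ := ((β * (L : ℝ) ^ 2 : ℝ) : ℂ) with hc
  set g : FreqMomentum L M → ℂ := propCT L M β μ K with hg
  -- the two guarded pairings of the six-point function
  set R₁ : FreqMomentum L M → FreqMomentum L M → FreqMomentum L M → FreqMomentum L M → FreqMomentum L M → FreqMomentum L M → ℂ :=
    fun k₁ k₂ k₄ k₁' k₂' k₃' => if k₂ = k₁ then (if k₃' = k₄ then (if k₂' = k₁' then c ^ 3 * g k₁ * g k₄ * g k₁' else 0) else 0) else 0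
    with hR₁
  set R₂ : FreqMomentum L M → FreqMomentum L M → FreqMomentum L M → FreqMomentum L M → FreqMomentum L M → FreqMomentum L M → ℂ :=
    fun k₁ k₂ k₄ k₁' k₂' k₃' => if k₂' = k₁ then (if k₁' = k₂ then (if k₃' = k₄ then c ^ 3 * g k₁ * g k₂ * g k₄ else 0) else 0) else 0
    with hR₂
  -- Step 1: expand into the six-fold guarded sum of six-point functions
  have h1 : gaussExpect ℂ (hubbardCovarianceCT L M β μ 0 K)
        (grassmannDeriv ℂ (((k, 1), 0) : HubbardFieldIdx L M) (hubbardInteraction L M β 1) *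
          grassmannDeriv ℂ (((k, 1), 1) : HubbardFieldIdx L M) (hubbardInteraction L M β 1)) =
      (((1 / (β * (L : ℝ) ^ 2) ^ 3 : ℝ) : ℂ)) ^ 2 *
        ∑ k₁ : FreqMomentum L M, ∑ k₂ : FreqMomentum L M, ∑ k₄ : FreqMomentum L M,
          if matsubaraInt M k₁.1 + matsubaraInt M k.1 = matsubaraInt M k₂.1 + matsubaraInt M k₄.1 ∧ k₁.2 + k.2 = k₂.2 + k₄.2 then
            ∑ k₁' : FreqMomentum L M, ∑ k₂' : FreqMomentum L M, ∑ k₃' : FreqMomentum L M,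
              (if matsubaraInt M k₁'.1 + matsubaraInt M k₃'.1 = matsubaraInt M k₂'.1 + matsubaraInt M k.1 ∧
                  k₁'.2 + k₃'.2 = k₂'.2 + k.2 then
                -(R₁ k₁ k₂ k₄ k₁' k₂' k₃' - R₂ k₁ k₂ k₄ k₁' k₂' k₃') else 0)
          else 0 := by
    rw [dPlus_down_hubbardInteraction, dMinus_down_hubbardInteraction, smul_mul_assoc, mul_smul_comm, map_smul, map_smul,
      smul_eq_mul, smul_eq_mul, show ∀ x y : ℂ, x * (x * y) = x ^ 2 * y from fun x y => by ring]
    congr 1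
    simp only [Finset.sum_mul, ite_mul, zero_mul]
    simp only [Finset.mul_sum, mul_ite, mul_zero, mul_neg]
    simp only [map_sum, gaussExpect_ite, map_neg]
    simp only [psiPlus, psiMinus, mul_assoc]
    simp only [gaussExpect_sixPoint_down hβ, hR₁, hR₂, hc, hg, mul_assoc]
  -- Step 2: split the inner sum
  have h2 : ∀ k₁ k₂ k₄ : FreqMomentum L M,
      (∑ k₁' : FreqMomentum L M, ∑ k₂' : FreqMomentum L M, ∑ k₃' : FreqMomentum L M,
        if matsubaraInt M k₁'.1 + matsubaraInt M k₃'.1 = matsubaraInt M k₂'.1 + matsubaraInt M k.1 ∧ k₁'.2 + k₃'.2 = k₂'.2 + k.2 then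
          -(R₁ k₁ k₂ k₄ k₁' k₂' k₃' - R₂ k₁ k₂ k₄ k₁' k₂' k₃') else 0) =
      -(∑ k₁' : FreqMomentum L M, ∑ k₂' : FreqMomentum L M, ∑ k₃' : FreqMomentum L M,
          if matsubaraInt M k₁'.1 + matsubaraInt M k₃'.1 = matsubaraInt M k₂'.1 + matsubaraInt M k.1 ∧ k₁'.2 + k₃'.2 = k₂'.2 + k.2 then
            R₁ k₁ k₂ k₄ k₁' k₂' k₃' else 0) +
        ∑ k₁' : FreqMomentum L M, ∑ k₂' : FreqMomentum L M, ∑ k₃' : FreqMomentum L M,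
          if matsubaraInt M k₁'.1 + matsubaraInt M k₃'.1 = matsubaraInt M k₂'.1 + matsubaraInt M k.1 ∧ k₁'.2 + k₃'.2 = k₂'.2 + k.2 then
            R₂ k₁ k₂ k₄ k₁' k₂' k₃' else 0 := by
    intro k₁ k₂ k₄
    rw [← Finset.sum_neg_distrib, ← Finset.sum_add_distrib]
    refine Finset.sum_congr rfl fun k₁' _ => ?_
    rw [← Finset.sum_neg_distrib, ← Finset.sum_add_distrib]
    refine Finset.sum_congr rfl fun k₂' _ => ?_
    rw [← Finset.sum_neg_distrib, ← Finset.sum_add_distrib]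
    refine Finset.sum_congr rfl fun k₃' _ => ?_
    split_ifs <;> ring
  -- Step 3: the direct pairing `R₁` forces `k₂ = k₁`, `k₃' = k₄`, `k₂' = k₁'`, and then `k₄ = k`
  have h3 : ∀ k₁ k₂ k₄ : FreqMomentum L M,
      (∑ k₁' : FreqMomentum L M, ∑ k₂' : FreqMomentum L M, ∑ k₃' : FreqMomentum L M,
        if matsubaraInt M k₁'.1 + matsubaraInt M k₃'.1 = matsubaraInt M k₂'.1 + matsubaraInt M k.1 ∧ k₁'.2 + k₃'.2 = k₂'.2 + k.2 then
          R₁ k₁ k₂ k₄ k₁' k₂' k₃' else 0) =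
      if k₂ = k₁ then (if k = k₄ then c ^ 3 * g k₁ * g k₄ * ∑ q : FreqMomentum L M, g q else 0) else 0 := by
    intro k₁ k₂ k₄
    by_cases h21 : k₂ = k₁
    · rw [if_pos h21]
      have hin : ∀ k₁' : FreqMomentum L M, (∑ k₂' : FreqMomentum L M, ∑ k₃' : FreqMomentum L M,
          if matsubaraInt M k₁'.1 + matsubaraInt M k₃'.1 = matsubaraInt M k₂'.1 + matsubaraInt M k.1 ∧ k₁'.2 + k₃'.2 = k₂'.2 + k.2 then
            R₁ k₁ k₂ k₄ k₁' k₂' k₃' else 0) =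
          if k = k₄ then c ^ 3 * g k₁ * g k₄ * g k₁' else 0 := by
        intro k₁'
        rw [Finset.sum_eq_single k₁']
        · rw [Finset.sum_eq_single k₄]
          · simp only [hR₁, h21, if_true, vertexConstraint_cancel_left_iff k₁' k₄ k]
          · intro k₃' _ h; simp [hR₁, h]
          · intro h; exact absurd (Finset.mem_univ _) h
        · intro k₂' _ h
          exact Finset.sum_eq_zero fun k₃' _ => by simp [hR₁, h]
        · intro h; exact absurd (Finset.mem_univ _) h
      simp only [hin]
      split_ifs
      · rw [Finset.mul_sum]
      · simp
    · rw [if_neg h21]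
      exact Finset.sum_eq_zero fun k₁' _ => Finset.sum_eq_zero fun k₂' _ => Finset.sum_eq_zero fun k₃' _ => by simp [hR₁, h21]
  -- Step 4: the exchange pairing `R₂` forces `k₁' = k₂`, `k₂' = k₁`, `k₃' = k₄`; the second constraint is then the first
  have h4 : ∀ k₁ k₂ k₄ : FreqMomentum L M,
      (∑ k₁' : FreqMomentum L M, ∑ k₂' : FreqMomentum L M, ∑ k₃' : FreqMomentum L M,
        if matsubaraInt M k₁'.1 + matsubaraInt M k₃'.1 = matsubaraInt M k₂'.1 + matsubaraInt M k.1 ∧ k₁'.2 + k₃'.2 = k₂'.2 + k.2 then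
          R₂ k₁ k₂ k₄ k₁' k₂' k₃' else 0) =
      if matsubaraInt M k₁.1 + matsubaraInt M k.1 = matsubaraInt M k₂.1 + matsubaraInt M k₄.1 ∧ k₁.2 + k.2 = k₂.2 + k₄.2 then
        c ^ 3 * g k₁ * g k₂ * g k₄ else 0 := by
    intro k₁ k₂ k₄
    rw [Finset.sum_eq_single k₂]
    · rw [Finset.sum_eq_single k₁]
      · rw [Finset.sum_eq_single k₄]
        · simp only [hR₂, if_true]
          have hiff : (matsubaraInt M k₂.1 + matsubaraInt M k₄.1 = matsubaraInt M k₁.1 + matsubaraInt M k.1 ∧ k₂.2 + k₄.2 = k₁.2 + k.2) ↔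
              (matsubaraInt M k₁.1 + matsubaraInt M k.1 = matsubaraInt M k₂.1 + matsubaraInt M k₄.1 ∧ k₁.2 + k.2 = k₂.2 + k₄.2) :=
            ⟨fun h => ⟨h.1.symm, h.2.symm⟩, fun h => ⟨h.1.symm, h.2.symm⟩⟩
          rw [if_congr hiff rfl rfl]
        · intro k₃' _ h; simp [hR₂, h]
        · intro h; exact absurd (Finset.mem_univ _) h
      · intro k₂' _ h
        exact Finset.sum_eq_zero fun k₃' _ => by simp [hR₂, h]
      · intro h; exact absurd (Finset.mem_univ _) h
    · intro k₁' _ h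
      exact Finset.sum_eq_zero fun k₂' _ => Finset.sum_eq_zero fun k₃' _ => by simp [hR₂, h]
    · intro h; exact absurd (Finset.mem_univ _) h
  -- Step 5: the outer sums
  have h5 : (∑ k₁ : FreqMomentum L M, ∑ k₂ : FreqMomentum L M, ∑ k₄ : FreqMomentum L M,
      if matsubaraInt M k₁.1 + matsubaraInt M k.1 = matsubaraInt M k₂.1 + matsubaraInt M k₄.1 ∧ k₁.2 + k.2 = k₂.2 + k₄.2 then
        (if k₂ = k₁ then (if k = k₄ then c ^ 3 * g k₁ * g k₄ * ∑ q : FreqMomentum L M, g q else 0) else 0) else 0) =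
      c ^ 3 * g k * (∑ q : FreqMomentum L M, g q) ^ 2 := by
    rw [pow_two, ← mul_assoc, Finset.mul_sum Finset.univ _ (c ^ 3 * g k), Finset.sum_mul]
    refine Finset.sum_congr rfl fun k₁ _ => ?_
    rw [Finset.sum_eq_single k₁]
    · rw [Finset.sum_eq_single k]
      · rw [if_pos ⟨rfl, rfl⟩, if_pos rfl, if_pos rfl]; ring
      · intro k₄ _ h; simp [Ne.symm h]
      · intro h; exact absurd (Finset.mem_univ _) h
    · intro k₂ _ h
      exact Finset.sum_eq_zero fun k₄ _ => by simp [h]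
    · intro h; exact absurd (Finset.mem_univ _) h
  have h6 : (∑ k₁ : FreqMomentum L M, ∑ k₂ : FreqMomentum L M, ∑ k₄ : FreqMomentum L M,
      if matsubaraInt M k₁.1 + matsubaraInt M k.1 = matsubaraInt M k₂.1 + matsubaraInt M k₄.1 ∧ k₁.2 + k.2 = k₂.2 + k₄.2 then
        (if matsubaraInt M k₁.1 + matsubaraInt M k.1 = matsubaraInt M k₂.1 + matsubaraInt M k₄.1 ∧ k₁.2 + k.2 = k₂.2 + k₄.2 then
          c ^ 3 * g k₁ * g k₂ * g k₄ else 0) else 0) =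
      c ^ 3 * ∑ k₂ : FreqMomentum L M, ∑ k₃ : FreqMomentum L M, ∑ k₄ : FreqMomentum L M,
        if matsubaraInt M k.1 + matsubaraInt M k₃.1 = matsubaraInt M k₂.1 + matsubaraInt M k₄.1 ∧ k.2 + k₃.2 = k₂.2 + k₄.2 then
          g k₂ * g k₃ * g k₄ else 0 := by
    rw [Finset.sum_comm]
    simp only [Finset.mul_sum]
    refine Finset.sum_congr rfl fun k₂ _ => Finset.sum_congr rfl fun k₃ _ => Finset.sum_congr rfl fun k₄ _ => ?_
    rw [add_comm (matsubaraInt M k.1) (matsubaraInt M k₃.1), add_comm k.2 k₃.2]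
    split_ifs <;> ring
  -- assemble
  rw [h1]
  simp only [h2, h3, h4]
  congr 1
  have hsplit : ∀ k₁ k₂ k₄ : FreqMomentum L M,
      (if matsubaraInt M k₁.1 + matsubaraInt M k.1 = matsubaraInt M k₂.1 + matsubaraInt M k₄.1 ∧ k₁.2 + k.2 = k₂.2 + k₄.2 then
        -(if k₂ = k₁ then (if k = k₄ then c ^ 3 * g k₁ * g k₄ * ∑ q : FreqMomentum L M, g q else 0) else 0) +
          (if matsubaraInt M k₁.1 + matsubaraInt M k.1 = matsubaraInt M k₂.1 + matsubaraInt M k₄.1 ∧ k₁.2 + k.2 = k₂.2 + k₄.2 then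
            c ^ 3 * g k₁ * g k₂ * g k₄ else 0)
       else 0) =
      -(if matsubaraInt M k₁.1 + matsubaraInt M k.1 = matsubaraInt M k₂.1 + matsubaraInt M k₄.1 ∧ k₁.2 + k.2 = k₂.2 + k₄.2 then
          (if k₂ = k₁ then (if k = k₄ then c ^ 3 * g k₁ * g k₄ * ∑ q : FreqMomentum L M, g q else 0) else 0) else 0) +
        (if matsubaraInt M k₁.1 + matsubaraInt M k.1 = matsubaraInt M k₂.1 + matsubaraInt M k₄.1 ∧ k₁.2 + k.2 = k₂.2 + k₄.2 then
          (if matsubaraInt M k₁.1 + matsubaraInt M k.1 = matsubaraInt M k₂.1 + matsubaraInt M k₄.1 ∧ k₁.2 + k.2 = k₂.2 + k₄.2 then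
            c ^ 3 * g k₁ * g k₂ * g k₄ else 0) else 0) := by
    intro k₁ k₂ k₄
    split_ifs <;> ring
  simp only [hsplit, Finset.sum_add_distrib, Finset.sum_neg_distrib, h5, h6]
  ring

end Summit.HubbardSuperconductivity.HubbardSuperconductivity.Theorems.TwoPointAssembly

end
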